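import Summits.NavierStokesRegularity.NavierStokesRegularity.Theses.RellichScar
import Summits.NavierStokesRegularity.NavierStokesRegularity.Theorems.SymmetricScarExists.Negative.SpiralWorld
import Summits.NavierStokesRegularity.NavierStokesRegularity.Theorems.ScarRigidity.Negative.LogicAndLoadBearing
import Literature.Analysis.FluidPDE.LocalTypeI
import Literature.Analysis.FluidPDE.TypeIAncientMild
import Summits.NavierStokesRegularity.NavierStokesRegularity.Theorems.RellichScarSymmetricScarExistsApexScarTrace
import Summits.NavierStokesRegularity.NavierStokesRegularity.Theorems.RellichScarSymmetricScarExistsLimitRepresentative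
import Summits.NavierStokesRegularity.NavierStokesRegularity.Theorems.RellichScarSymmetricScarExistsSlabLimit
import Summits.NavierStokesRegularity.NavierStokesRegularity.Theorems.RellichScarSymmetricScarExistsScarDefectLimit
import Summits.NavierStokesRegularity.NavierStokesRegularity.Theorems.RellichScarSymmetricScarExistsScaleWindowRigidity
import Summits.NavierStokesRegularity.NavierStokesRegularity.Theorems.RellichScarSymmetricScarExistsRotWindowRigidity
import Summits.NavierStokesRegularity.NavierStokesRegularity.Theorems.RellichScarSymmetricScarExistsFlatSourceTransfer
import Summits.NavierStokesRegularity.NavierStokesRegularity.Theorems.RellichScarSymmetricScarExistsSmallConstant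

/-!
# Line `analytic-scar-window-rigidity` for the crux `SymmetricScarExists` (stmt-NavierStokesRegularity-11718)

Lead prover's SKELETON (continuation lead c1), RESHAPED to the GROUP-WINDOW form; **v4 (continuation lead c2,
2026-08-16T14:00Z): owned unchanged — stub set, names and signatures identical to v3; the only open stub is the bet
`stub_flatSource`, which the tree theorem `ScarWindow.flatSource_iff_symmetricScarExists` (p103671) proves EQUIVALENT to
the crux, so no non-circular work is left inside this line (see `Lines/analytic-scar-window-rigidity.dead.md`).**

**v2 (after wave 1, 2026-08-16T12:10Z): ALL SIX known-mathematics stubs LANDED** (sorry-free, axioms clean,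
`--supports stmt-NavierStokesRegularity-11718`, namespace `…Theorems.SymmetricScarExists.ScarWindow`):
`stub_apexScarTrace` p97604, `stub_limitRepresentative` p97536, `stub_slabLimit` p97149, `stub_scarDefectLimit`
p100507 (+ lemmas p98697), `stub_scaleWindowRigidity` p97372, `stub_rotWindowRigidity` p98452.  This file now imports
them; the ONLY remaining `sorry` is the bet `stub_flatSource`.  The line is CLOSED MODULO THE BET.

**v3 (2026-08-16T13:10Z): the TRANSFER is a tree theorem** — `symmetricScarExists_of_flatSource` (bet ⇒ crux, the
composition below, p103671 `Theorems/RellichScarSymmetricScarExistsFlatSourceTransfer.lean`), together with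
`flatSource_of_symmetricScarExists` (crux ⇒ bet), `flatSource_iff_symmetricScarExists` (the bet is an EQUIVALENT,
compactness-upgraded form of the crux) and the calibration `flatSource_iff_noApexTypeIProfile` (granted the sibling crux
`ScarRigidity`, bet ⇔ route target; the three supports of the costume are proved tree theorems).  Also landed: the
small-constant fragment `no_singular_apex_profile_smallConstant` / `symmetricScarExists_smallConstant` (p102142, KNSS gap:
every instance `C < c₀` of the crux holds outright) and the Fatal for the planner's foreseen third alternative
"λ-DSS scar, λ < λ_*(C)": `dssApexFatal_nearOne` (p105416, Chae–Wolf 2017 Thm 1.3 in the apex class,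
`Theorems/RellichScarSymmetricScarExistsDssNearOne.lean`).  HONEST STATUS: the bet is crux-equivalent by a kernel-checked
theorem; inside the route's belief system (ScarRigidity) it is the target X = "no Type-I apex blow-up profile" (open).

The planners' line (registered stubs `stub_flatWindowSource` [bet], `stub_compactUpgrade` [L],
`stub_analyticScar` [L–XL], `stub_windowRigidity` [M]) reads: an ε-flat window of the scar (flat under
the rescalings `λ ∈ [1, 1+η]`, resp. the rotations `θ ∈ [0, η]`, on ONE compact `K ∌ 0` with interior),
upgraded by compactness to an exactly flat window, is upgraded by real-analyticity of the scar to a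
global symmetry of the scar — the crux's conclusion.  The reshape keeps the composition
(ε-flat family → compactness upgrade → window rigidity → crux) and moves the window into the GROUP
PARAMETER only: flatness is asked for `λ` (resp. `θ`) in a non-trivial interval `[a, b]` but on EVERY
compact `K ∌ 0`.  Then "window ⇒ whole group" is the algebra of the one-parameter groups `λ ↦ D_λ`,
`θ ↦ R_θ` acting on scars (`SameScar` is an equivalence relation, covariant under both actions; a
subgroup of `ℝ₊ˣ` resp. `ℝ` containing an interval is everything), and the real-analyticity of the
final-time trace (true — Kahane 1969 / Bradshaw–Grujić–Kukavica 2015 — but XL in Lean: the tree's BGK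
fact carries no bound on the holomorphic extension, so the `t ↑ 0` Vitali step is unavailable) is not
needed.  Given compactness + analyticity the reshaped bet is EQUIVALENT to the filed one.

## Registered stubs (v1)

* `stub_flatSource` — THE BET (held by the lead): if a singular apex profile exists, then for some
  constant `C'`, bound `I < ∞` and window `[a, b]` there is a SEQUENCE of singular apex profiles
  (`𝐈 ≤ I`, decay `C'`) along which the homogeneity defect of the scar at every scale `λ ∈ [a, b]`
  (`0 < a`), or the axisymmetry defect at every angle `θ ∈ [a, b]`, tends to zero on every compact
  `K ∌ 0`.  Calibration: vacuous in the (L)-world; FALSE in the spiral / λ-DSS world of Disproof §4–§5;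
  under `ScarRigidity` X-equivalent (Disproof §8) — like every line for this crux.
* `stub_apexScarTrace` (M, KNOWN): every Type-I ancient mild field with the apex bound has a SCAR
  `σ` — `‖V(t,x) − σ(x)‖ ≤ L(−t)/‖x‖³`, `‖σ(x)‖ ≤ C/‖x‖`, `σ` locally Lipschitz off the origin — with ONE
  constant `L = L(C)` (from the landed `apexDerivativeBounds_gaugeFree`: `‖∂ₜV‖ ≤ L/(‖x‖+√−t)³`,
  `‖∇V‖ ≤ L/(‖x‖+√−t)²`).
* `stub_limitRepresentative` (M, KNOWN): `L³_loc` convergence of Type-I ancient mild fields with a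
  common apex constant is pointwise convergence on `t < 0` (equi-Lipschitz representatives).
* `stub_slabLimit` (M–L, KNOWN): a sequence of singular apex profiles with `𝐈 ≤ I < ∞` and a common
  constant subconverges in `L³(Q(0,R))`, `R > 0`, to a singular apex profile with the same constant
  (`slab_typeI_compactness` = A–B Lemma 2.2 + Prop. 2.3 on the slab, `exists_apex_profile_repr`).
* `stub_scarDefectLimit` (L, KNOWN, conditional on the statements of `stub_apexScarTrace` and
  `stub_limitRepresentative`): along an `L³_loc`-convergent sequence of apex profiles with a common
  constant, "scale-`λ` defect → 0 on every compact `K ∌ 0`" passes to the limit as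
  `SameScar (nsRescale λ u) u`, and likewise for the rotation-conjugates `conjZ θ`.
* `stub_scaleWindowRigidity` (M, KNOWN): `SameScar (nsRescale λ u) u` for all `λ` in a window
  `[a, b] ⊂ (0, ∞)`, `a < b`, gives `HomScar u`.
* `stub_rotWindowRigidity` (M, KNOWN): `SameScar (conjZ θ u) u` for all `θ ∈ [a, b]`, `a < b`, gives
  `AxiScar u`.

Composition `symmetricScarExists_proof : SymmetricScarExists` (the crux BY NAME), sorry-free modulo
the stubs.  Vocabulary: `SameScar`, `HomScar`, `AxiScar`, `conjZ` of the landed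
`Theorems/SymmetricScarExists/Negative/SpiralWorld.lean` (readback `symmetricScarExists_iff_homScar_or_axiScar`
is `Iff.rfl`); `hasTypeIDecay_mono`, `nonneg_of_hasTypeIDecay` of the landed
`Theorems/ScarRigidity/Negative/LogicAndLoadBearing.lean`.
-/

noncomputable section

open MeasureTheory Set Function Filter Topology TopologicalSpace Metric
open scoped NNReal ENNReal

namespace Summit.NavierStokesRegularity.NavierStokesRegularity.Cruxes.SymmetricScarExists.Lines.AnalyticScarWindowRigidity

open Literature.Analysis.FluidPDE
open Summit.NavierStokesRegularity.NavierStokesRegularity.Theses.RellichScar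
open Summit.NavierStokesRegularity.NavierStokesRegularity.Theorems.SymmetricScarExists.Negative
open Summit.NavierStokesRegularity.NavierStokesRegularity.Theorems.ScarRigidity.Negative (hasTypeIDecay_mono)
open Summit.NavierStokesRegularity.NavierStokesRegularity.Theorems.SymmetricScarExists.ScarWindow

set_option linter.dupNamespace false

/-! ## Registered stubs -/

/-- STUB A — THE BET (`stub_flatSource`, held by the lead).  If a singular apex profile exists, then
for some `C'`, `I < ∞` and a non-trivial window `[a, b]` there is a sequence of singular apex profiles
(suitable weak on the slab, weak gradient, `𝐈 ≤ I`, decay `C'`, singular origin) along which EITHER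
the homogeneity defect of the scar at every scale `λ ∈ [a, b]` (`0 < a`) OR the axisymmetry defect at
every angle `θ ∈ [a, b]` tends to zero, essentially near the final slice, on every compact `K ∌ 0`. -/
theorem stub_flatSource :
    ∀ C : ℝ, (∃ (u : ℝ → EuclideanSpace ℝ (Fin 3) → EuclideanSpace ℝ (Fin 3)) (p : ℝ → EuclideanSpace ℝ (Fin 3) → ℝ) (G : ℝ → EuclideanSpace ℝ (Fin 3) → EuclideanSpace ℝ (Fin 3) →L[ℝ] EuclideanSpace ℝ (Fin 3)), IsSuitableWeakSolutionOn (slab (EuclideanSpace ℝ (Fin 3)) (Iio (0 : ℝ)) isOpen_Iio) 1 0 u p ∧ HasWeakSpatialGradientOn (slab (EuclideanSpace ℝ (Fin 3)) (Iio (0 : ℝ)) isOpen_Iio) u G ∧ typeIBound (Iio (0 : ℝ) ×ˢ univ) u p G < ⊤ ∧ HasTypeIDecay C u ∧ IsBackwardSingularPoint u 0) →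
      ∃ (C' : ℝ) (I : ℝ≥0∞) (a b : ℝ) (v : ℕ → ℝ → EuclideanSpace ℝ (Fin 3) → EuclideanSpace ℝ (Fin 3)) (q : ℕ → ℝ → EuclideanSpace ℝ (Fin 3) → ℝ) (H : ℕ → ℝ → EuclideanSpace ℝ (Fin 3) → EuclideanSpace ℝ (Fin 3) →L[ℝ] EuclideanSpace ℝ (Fin 3)),
        I < ⊤ ∧ a < b ∧
        (∀ k : ℕ, IsSuitableWeakSolutionOn (slab (EuclideanSpace ℝ (Fin 3)) (Iio (0 : ℝ)) isOpen_Iio) 1 0 (v k) (q k) ∧ HasWeakSpatialGradientOn (slab (EuclideanSpace ℝ (Fin 3)) (Iio (0 : ℝ)) isOpen_Iio) (v k) (H k) ∧ typeIBound (Iio (0 : ℝ) ×ˢ univ) (v k) (q k) (H k) ≤ I ∧ HasTypeIDecay C' (v k) ∧ IsBackwardSingularPoint (v k) 0) ∧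
        ((0 < a ∧ ∀ lam ∈ Icc a b, ∀ K : Set (EuclideanSpace ℝ (Fin 3)), IsCompact K → (0 : EuclideanSpace ℝ (Fin 3)) ∉ K → ∀ ε : ℝ, 0 < ε → ∀ᶠ k in atTop, ∀ᶠ δ in 𝓝[>] (0 : ℝ), eLpNorm (uncurry (nsRescale lam (v k)) - uncurry (v k)) ⊤ (volume.restrict (Ioo (-δ) 0 ×ˢ K)) ≤ ENNReal.ofReal ε) ∨
         (∀ θ ∈ Icc a b, ∀ K : Set (EuclideanSpace ℝ (Fin 3)), IsCompact K → (0 : EuclideanSpace ℝ (Fin 3)) ∉ K → ∀ ε : ℝ, 0 < ε → ∀ᶠ k in atTop, ∀ᶠ δ in 𝓝[>] (0 : ℝ), eLpNorm (uncurry (conjZ θ (v k)) - uncurry (v k)) ⊤ (volume.restrict (Ioo (-δ) 0 ×ˢ K)) ≤ ENNReal.ofReal ε)) := by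
  sorry

/-! STUBS B1 `stub_apexScarTrace`, B2 `stub_limitRepresentative`, B3a `stub_slabLimit`, B3b `stub_scarDefectLimit`,
C `stub_scaleWindowRigidity`, C′ `stub_rotWindowRigidity`: LANDED (wave 1) under the same names in namespace
`Summit.NavierStokesRegularity.NavierStokesRegularity.Theorems.SymmetricScarExists.ScarWindow` (opened below), files
`Theorems/RellichScarSymmetricScarExists{ApexScarTrace,LimitRepresentative,SlabLimit,ScarDefectLimit(Lemmas),ScaleWindowRigidity,RotWindowRigidity}.lean`. -/

/-! ## Composition (sorry-free modulo the bet) -/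

/-- **The bet proves the crux** `SymmetricScarExists` BY NAME, through the landed transfer theorem
`symmetricScarExists_of_flatSource` (p103671): the bet's sequence (decay constant bumped to `|C'| + 1 > 0`)
subconverges to a singular apex profile (`stub_slabLimit`); along the subsequence the scar defects still tend to
zero, so the limit's scar is flat on the whole window (`stub_scarDefectLimit` fed with `stub_apexScarTrace`,
`stub_limitRepresentative`); window rigidity (`stub_scaleWindowRigidity` / `stub_rotWindowRigidity`) makes it
(−1)-homogeneous, resp. axisymmetric. -/
theorem symmetricScarExists_proof : SymmetricScarExists :=
  symmetricScarExists_of_flatSource stub_flatSource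

/-- Conversely the crux implies the bet (landed `flatSource_of_symmetricScarExists`), so the line's bet is an
equivalent form of the crux: readback of the landed `flatSource_iff_symmetricScarExists`. -/
example :
    (∀ C : ℝ, (∃ (u : ℝ → EuclideanSpace ℝ (Fin 3) → EuclideanSpace ℝ (Fin 3)) (p : ℝ → EuclideanSpace ℝ (Fin 3) → ℝ) (G : ℝ → EuclideanSpace ℝ (Fin 3) → EuclideanSpace ℝ (Fin 3) →L[ℝ] EuclideanSpace ℝ (Fin 3)), IsSuitableWeakSolutionOn (slab (EuclideanSpace ℝ (Fin 3)) (Iio (0 : ℝ)) isOpen_Iio) 1 0 u p ∧ HasWeakSpatialGradientOn (slab (EuclideanSpace ℝ (Fin 3)) (Iio (0 : ℝ)) isOpen_Iio) u G ∧ typeIBound (Iio (0 : ℝ) ×ˢ univ) u p G < ⊤ ∧ HasTypeIDecay C u ∧ IsBackwardSingularPoint u 0) →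
      ∃ (C' : ℝ) (I : ℝ≥0∞) (a b : ℝ) (v : ℕ → ℝ → EuclideanSpace ℝ (Fin 3) → EuclideanSpace ℝ (Fin 3)) (q : ℕ → ℝ → EuclideanSpace ℝ (Fin 3) → ℝ) (H : ℕ → ℝ → EuclideanSpace ℝ (Fin 3) → EuclideanSpace ℝ (Fin 3) →L[ℝ] EuclideanSpace ℝ (Fin 3)),
        I < ⊤ ∧ a < b ∧
        (∀ k : ℕ, IsSuitableWeakSolutionOn (slab (EuclideanSpace ℝ (Fin 3)) (Iio (0 : ℝ)) isOpen_Iio) 1 0 (v k) (q k) ∧ HasWeakSpatialGradientOn (slab (EuclideanSpace ℝ (Fin 3)) (Iio (0 : ℝ)) isOpen_Iio) (v k) (H k) ∧ typeIBound (Iio (0 : ℝ) ×ˢ univ) (v k) (q k) (H k) ≤ I ∧ HasTypeIDecay C' (v k) ∧ IsBackwardSingularPoint (v k) 0) ∧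
        ((0 < a ∧ ∀ lam ∈ Icc a b, ∀ K : Set (EuclideanSpace ℝ (Fin 3)), IsCompact K → (0 : EuclideanSpace ℝ (Fin 3)) ∉ K → ∀ ε : ℝ, 0 < ε → ∀ᶠ k in atTop, ∀ᶠ δ in 𝓝[>] (0 : ℝ), eLpNorm (uncurry (nsRescale lam (v k)) - uncurry (v k)) ⊤ (volume.restrict (Ioo (-δ) 0 ×ˢ K)) ≤ ENNReal.ofReal ε) ∨
         (∀ θ ∈ Icc a b, ∀ K : Set (EuclideanSpace ℝ (Fin 3)), IsCompact K → (0 : EuclideanSpace ℝ (Fin 3)) ∉ K → ∀ ε : ℝ, 0 < ε → ∀ᶠ k in atTop, ∀ᶠ δ in 𝓝[>] (0 : ℝ), eLpNorm (uncurry (conjZ θ (v k)) - uncurry (v k)) ⊤ (volume.restrict (Ioo (-δ) 0 ×ˢ K)) ≤ ENNReal.ofReal ε))) ↔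
    SymmetricScarExists :=
  flatSource_iff_symmetricScarExists

end Summit.NavierStokesRegularity.NavierStokesRegularity.Cruxes.SymmetricScarExists.Lines.AnalyticScarWindowRigidity

end
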